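import Summits.BirchSwinnertonDyer.BirchSwinnertonDyer.Theorems.AdditiveBranchIMCTwistFieldItems
import HarnessLib

/-!
# Crux `GordTwoRankZeroOffCaseOne` (route `AdditiveBranchIMC`, item 19357), lane k1-c2x: «no free lunch»
# in tree currency — on the Skinner–Urban rows the K-level input over the twist field IS the branch input
# (sequel of `…TwistFieldItems`)

Cell `bsd-addord`, seat `bsd-addord-k1-c2x` (second prover lane on item 19357; director-bsd 2026-08-27:
«uniform IMC-branch divisibility via Skinner–Urban over the quadratic twist field with explicit control at
the additive prime»). HONEST FRAMING: theorems only; the published inputs are DISPLAYED named-fact binders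
(`skinner_urban_main_conjecture` — Skinner–Urban 2014 Thm. 3.6.9, with the tree's ACTIVE-PRINT-GAP flag
at `p = 3`; Kato's component reading `hK`); the K-level containment and the branch containment are typed
predicates, nothing is asserted about either; nothing is booked; BSD is not proved by any of this.

`twistFieldLowerDivisibility[Even|Odd]At_of_skinnerUrban_of_chiBranchLower[Odd]`: for `V/ℚ` good
ordinary at the odd `p` with `V[p]` irreducible, the S–U auxiliary multiplicative prime and `ρ_{V,pⁿ}`
onto for all `n`, the branch containment `ChiBranchLowerDivisibility[Odd]At (V^{(p*)}) p` implies the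
K-level containment `TwistFieldLowerDivisibility[Even|Odd]At V p` (the `⇐` theorem of `…Reduction` fed
with S–U's integral main conjecture for `V/ℚ_∞` and Kato's torsion). Together with `…Items` §2 (`⇒`):
on these rows the twist-field road and the `ω^{(p−1)/2}`-branch road of items 19497/19498 require THE
SAME unprinted theorem; stating it over `K = ℚ(√p*)` (an elliptic curve with good ordinary reduction at
the RAMIFIED prime above `p`, no branch, no additive reduction) is a change of language, not of content —
the value of the road is that a K-level proof (Eisenstein congruences for `GL₂/K` or `GU(2,2)/K` at a
ramified `p`) need not see the branch decomposition at all.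

References: Skinner–Urban, Invent. Math. 195 (2014) Thm. 3.6.9 [SkinnerUrban2014]; K. Kato, Astérisque
295 (2004) Thm. 17.4 [Kato2004Asterisque]; R. Greenberg, LNM 1716 (1999) §5 [GreenbergLNM1716];
Burungale–Castella–Skinner, IMRN 2025 §5 (5.2)–(5.3) (the same product-and-cancel mechanism over
auxiliary fields with `p` inert/split) [BurungaleCastellaSkinner2025].
-/

set_option autoImplicit false
set_option linter.dupNamespace false

noncomputable section

open scoped Classical MatrixGroups ModularForm

open CongruenceSubgroup WeierstrassCurve NumberField IsDedekindDomain
  Literature.NumberTheory.EllipticCurves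
  Literature.NumberTheory.EllipticCurves.ModularForms
  Literature.NumberTheory.EllipticCurves.Rank1Residual
  Literature.NumberTheory.EllipticCurves.Rank1Residual.Typed
  Literature.NumberTheory.GaloisRepresentations

namespace Summit.BirchSwinnertonDyer.BirchSwinnertonDyer.Theorems.AdditiveBranchIMCTwistField

open Summit.BirchSwinnertonDyer.Rank1Residual.Additive
open Summit.BirchSwinnertonDyer.BirchSwinnertonDyer.Theorems.AdditiveBranchIMCGordTwoRankZeroLambdaAdic
open Summit.BirchSwinnertonDyer.BirchSwinnertonDyer.Theorems.AdditiveBranchIMCGordTwoRankZeroLambdaAdicOdd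

/-! ## §4 «No free lunch» in tree currency: on Skinner–Urban rows the K-level input IS the branch input -/

section NoFreeLunch

variable {p : ℕ} [hp : Fact p.Prime]

/-- **`⇐` on the Skinner–Urban rows, even branch.** For `V/ℚ` globally minimal, good ordinary at
`p ≡ 1 (mod 4)`, with `V[p]` irreducible, the S–U auxiliary prime (`haux`) and `ρ_{V,pⁿ}` onto for all
`n`: Skinner–Urban's integral main conjecture for `V/ℚ_∞` (`skinner_urban_main_conjecture`, displayed)
and the branch containment `ChiBranchLowerDivisibilityAt (V^{(p)}) p` for the twist (displayed), with
Kato's component reading `hK` (torsion of `X(V^{(p)}/ℚ_∞)`), give the K-level containment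
`TwistFieldLowerDivisibilityEvenAt V p`. With §2 (`⇒`) this says: on these rows the twist-field road and
the branch road ask for the SAME statement. [cite: SkinnerUrban2014, Thm. 3.6.9 (p. 45)]
[cite: Kato2004Asterisque, Thm. 17.4 (p. 273)] [cite: GreenbergLNM1716, §5 p. 143] -/
theorem twistFieldLowerDivisibilityEvenAt_of_skinnerUrban_of_chiBranchLower
    (V : WeierstrassCurve ℚ) [V.IsElliptic] [V.IsGloballyMinimal]
    (hSU : ∀ (κ : ZpExtension ℚ p) (γ : Field.absoluteGaloisGroup ℚ) (N : ℕ) [NeZero N]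
      (f : CuspForm (Gamma0 N) 2), skinner_urban_main_conjecture V p (κ := κ) (γ := γ) (f := f))
    (hK : Kato2004.charIdeal_dvd_padicLFunctionBranch_component_of_surjective)
    (hp1 : p % 4 = 1) (hV : GoodOrd V p) (hirr : V.HasIrreducibleModPGaloisRep p)
    (haux : ∃ ℓ : ℕ, ∃ _ : Fact ℓ.Prime, ℓ ≠ p ∧ V.HasMultiplicativeReductionAtPrime ℓ ∧
      ¬ p ∣ padicValInt ℓ V.minimalDiscriminantInt)
    (htower : ∀ n : ℕ, V.HasSurjectiveModNGaloisRep (p ^ n : ℕ))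
    (hW : ChiBranchLowerDivisibilityAt (V.quadraticTwist (p : ℚ)) p) :
    TwistFieldLowerDivisibilityEvenAt V p := by
  intro K _ _ _ θ κ γ N _ f _ h2 hθ hcK _ hκ hγ hγ' hγK hf DK ϖ hϖ g hg
  have hp2 : p ≠ 2 := by rintro rfl; norm_num at hp1
  have hp3 : 3 ≤ p := by
    have := hp.out.two_le
    omega
  have hpne : (p : ℚ) ≠ 0 := Nat.cast_ne_zero.mpr hp.out.ne_zero
  haveI : (V.quadraticTwist (p : ℚ)).IsElliptic := V.isElliptic_quadraticTwist hpne
  have hCW : (1 : VariableChange ℚ) • V.quadraticTwist (p : ℚ) = V.quadraticTwist (p : ℚ) := one_smul _ _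
  let DV : V.SelmerDualData κ γ := V.selmerDualData κ hγ
  let D : (V.quadraticTwist (p : ℚ)).SelmerDualData κ γ := (V.quadraticTwist (p : ℚ)).selmerDualData κ hγ
  haveI : Module.Finite (IwasawaAlgebra p) DV.X :=
    SelmerDualData.module_finite_of_isCyclotomic V κ hκ DV hγ
  haveI : Module.Finite (IwasawaAlgebra p) D.X :=
    SelmerDualData.module_finite_of_isCyclotomic (V.quadraticTwist (p : ℚ)) κ hκ D hγ
  obtain ⟨hVt, -, hint⟩ := hSU κ γ N f hp3 hV.1 hV.2 hirr haux hκ hγ hγ' hf DV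
  obtain ⟨gV, hιgV, hspan⟩ := hint htower
  have hDt : D.IsTorsion :=
    isTorsion_of_katoComponent hK V hp1 ⟨1, hCW⟩ hV htower hκ hγ hγ' hf D ϖ hϖ
  refine forall_exists_eq_mul_mul_of_lower_of_branchLower V K h2 hθ p κ hcK hCW hp2 hγ hγK DK DV D
    hVt hDt (fun x hx ↦ ?_) (fun y hy ↦ hW V hp1 ⟨1, hCW⟩ hV hκ hγ hγ' hf D ϖ hϖ y hy) g hg
  rw [hspan] at hx
  obtain ⟨h, hh⟩ := Ideal.mem_span_singleton'.mp hx
  exact ⟨h, by rw [← hh, map_mul, hιgV]⟩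

/-- **`⇐` on the Skinner–Urban rows, odd branch** (`p ≡ 3 (mod 4)`, `p = 3` included — where the S–U
fact carries the tree's ACTIVE-PRINT-GAP flag `SU14-12.3.6-mu@nonsplit@3`): the K-level containment
`TwistFieldLowerDivisibilityOddAt V p` from `skinner_urban_main_conjecture` for `V`, the branch
containment `ChiBranchLowerDivisibilityOddAt (V^{(−p)}) p` and Kato's `hK`.
[cite: SkinnerUrban2014, Thm. 3.6.9 (p. 45)] [cite: Kato2004Asterisque, Thm. 17.4 (p. 273)]
[cite: GreenbergLNM1716, §5 p. 143] -/
theorem twistFieldLowerDivisibilityOddAt_of_skinnerUrban_of_chiBranchLowerOdd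
    (V : WeierstrassCurve ℚ) [V.IsElliptic] [V.IsGloballyMinimal]
    (hSU : ∀ (κ : ZpExtension ℚ p) (γ : Field.absoluteGaloisGroup ℚ) (N : ℕ) [NeZero N]
      (f : CuspForm (Gamma0 N) 2), skinner_urban_main_conjecture V p (κ := κ) (γ := γ) (f := f))
    (hK : Kato2004.charIdeal_dvd_padicLFunctionBranch_component_of_surjective)
    (hp3 : p % 4 = 3) (hV : GoodOrd V p) (hirr : V.HasIrreducibleModPGaloisRep p)
    (haux : ∃ ℓ : ℕ, ∃ _ : Fact ℓ.Prime, ℓ ≠ p ∧ V.HasMultiplicativeReductionAtPrime ℓ ∧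
      ¬ p ∣ padicValInt ℓ V.minimalDiscriminantInt)
    (htower : ∀ n : ℕ, V.HasSurjectiveModNGaloisRep (p ^ n : ℕ))
    (hW : ChiBranchLowerDivisibilityOddAt (V.quadraticTwist (-(p : ℚ))) p) :
    TwistFieldLowerDivisibilityOddAt V p := by
  intro K _ _ _ θ κ γ N _ f _ h2 hθ hcK _ hκ hγ hγ' hγK hf DK ϖ hϖ g hg
  have hp2 : p ≠ 2 := by rintro rfl; norm_num at hp3
  have hp3' : 3 ≤ p := by
    have := hp.out.two_le
    omega
  have hpne : (-(p : ℚ)) ≠ 0 := neg_ne_zero.mpr (Nat.cast_ne_zero.mpr hp.out.ne_zero)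
  haveI : (V.quadraticTwist (-(p : ℚ))).IsElliptic := V.isElliptic_quadraticTwist hpne
  have hCW : (1 : VariableChange ℚ) • V.quadraticTwist (-(p : ℚ)) = V.quadraticTwist (-(p : ℚ)) :=
    one_smul _ _
  let DV : V.SelmerDualData κ γ := V.selmerDualData κ hγ
  let D : (V.quadraticTwist (-(p : ℚ))).SelmerDualData κ γ :=
    (V.quadraticTwist (-(p : ℚ))).selmerDualData κ hγ
  haveI : Module.Finite (IwasawaAlgebra p) DV.X :=
    SelmerDualData.module_finite_of_isCyclotomic V κ hκ DV hγ
  haveI : Module.Finite (IwasawaAlgebra p) D.X :=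
    SelmerDualData.module_finite_of_isCyclotomic (V.quadraticTwist (-(p : ℚ))) κ hκ D hγ
  obtain ⟨hVt, -, hint⟩ := hSU κ γ N f hp3' hV.1 hV.2 hirr haux hκ hγ hγ' hf DV
  obtain ⟨gV, hιgV, hspan⟩ := hint htower
  have hDt : D.IsTorsion :=
    isTorsion_of_katoComponent_odd hK V hp3 ⟨1, hCW⟩ hV htower hκ hγ hγ' hf D ϖ hϖ
  refine forall_exists_eq_mul_mul_of_lower_of_branchLower V K h2 hθ p κ hcK hCW hp2 hγ hγK DK DV D
    hVt hDt (fun x hx ↦ ?_) (fun y hy ↦ hW V hp3 ⟨1, hCW⟩ hV hκ hγ hγ' hf D ϖ hϖ y hy) g hg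
  rw [hspan] at hx
  obtain ⟨h, hh⟩ := Ideal.mem_span_singleton'.mp hx
  exact ⟨h, by rw [← hh, map_mul, hιgV]⟩

end NoFreeLunch

/-! ## §5 Kato over the twist field: the OPPOSITE containment for `X(V/K·ℚ_∞)` is already a consequence
of the tree's Kato facts (so over `K` exactly the typed lower containment is missing) -/

section KatoOverK

variable {p : ℕ} [hp : Fact p.Prime]

/-- **Kato's divisibility for `V` over the cyclotomic `ℤ_p`-extension of the twist field, even case**
(`p ≡ 1 (mod 4)`, `K = ℚ(√p)`): on a tower-surjective good ordinary `V`, for every tower datum `D_K` of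
`X(V/K·ℚ_∞)` at a generator `γ ∈ Gal(ℚ̄/K)` there is `g ∈ char_Λ X(V/K·ℚ_∞)` with
`ι g = u · L_p(f, α, T) · (ϖ·L_p(f, α, ω^{(p−1)/2}, T))`, `u ∈ ℤ_p^×` — the product of Kato's element for
`V/ℚ_∞` (`kato_divisibility` (3)) and Kato's element on the `ω^{(p−1)/2}`-component (`hK`, through
k1-c2's `exists_mem_charIdeal_eq_unit_mul_branch_of_katoComponent`) lies in
`char X(V/ℚ_∞)·char X(W/ℚ_∞) = char X(V/K·ℚ_∞)` (this lane). So over `K` the containment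
`(𝓛_K(V)) ⊆ char` is a theorem modulo the displayed facts, and the road's input
`TwistFieldLowerDivisibilityEvenAt` is exactly the converse. [cite: Kato2004Asterisque, Thm. 17.4 (p. 273)]
[cite: GreenbergLNM1716, §5 p. 143] -/
theorem exists_mem_charIdeal_towerDual_of_kato
    (hkato : ∀ (V : WeierstrassCurve ℚ) [V.IsElliptic] [V.IsGloballyMinimal] (κ : ZpExtension ℚ p)
      (γ : Field.absoluteGaloisGroup ℚ) (N : ℕ) [NeZero N] (f : CuspForm (Gamma0 N) 2),
      kato_divisibility V p (κ := κ) (γ := γ) (f := f))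
    (hK : Kato2004.charIdeal_dvd_padicLFunctionBranch_component_of_surjective)
    (V : WeierstrassCurve ℚ) [V.IsElliptic] [V.IsGloballyMinimal] (K : Type) [Field K] [NumberField K]
    (h2 : Module.finrank ℚ K = 2) {θ : K} (hθ : θ ∉ Set.range (algebraMap ℚ K))
    (hcK : θ ^ 2 = algebraMap ℚ K (p : ℚ)) (κ : ZpExtension ℚ p) [(galRange (K := ℚ) K).Normal]
    {W : WeierstrassCurve ℚ} [W.IsElliptic] {C : VariableChange ℚ}
    (hCW : C • V.quadraticTwist (p : ℚ) = W) {γ : Field.absoluteGaloisGroup ℚ} {N : ℕ} [NeZero N]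
    {f : CuspForm (Gamma0 N) 2} (hp1 : p % 4 = 1) (hV : GoodOrd V p)
    (htower : ∀ n : ℕ, V.HasSurjectiveModNGaloisRep (p ^ n : ℕ)) (hκ : κ.IsCyclotomic)
    (hγ : κ.IsTopGenerator γ) (hγ' : IsCyclotomicVariable p γ) (hγK : γ ∈ galRange (K := ℚ) K)
    (hf : IsNewformOf V f) (D_K : TowerSelmerDualData V κ K γ) (ϖ : ℚ)
    (hϖ : (ϖ : ℝ) * V.realPeriodRat = plusPeriod f) :
    ∃ g ∈ Literature.NumberTheory.EllipticCurves.Module.charIdeal (IwasawaAlgebra p) D_K.X,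
      ∃ u : ℤ_[p]ˣ, iwasawaToPowerSeries p g =
        PowerSeries.C ((u : ℤ_[p]) : ℚ_[p]) * (padicLFunction f (unitRoot V p : ℚ_[p]) *
          (PowerSeries.C ((ϖ : ℚ) : ℚ_[p]) * padicLFunctionBranch f (unitRoot V p : ℚ_[p]) (p / 2))) := by
  have hp2 : p ≠ 2 := by rintro rfl; norm_num at hp1
  have hpne : (p : ℚ) ≠ 0 := Nat.cast_ne_zero.mpr hp.out.ne_zero
  haveI : (V.quadraticTwist (p : ℚ)).IsElliptic := V.isElliptic_quadraticTwist hpne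
  have hjW : 0 ≤ padicValRat p W.j := by
    have hj : W.j = V.j := by subst hCW; rw [variableChange_j, V.j_quadraticTwist hpne]
    rw [hj, Summit.BirchSwinnertonDyer.Rank1Residual.EisensteinPrimes.padicValRat_j_eq_of_good V p hV.1]
    positivity
  let DV : V.SelmerDualData κ γ := V.selmerDualData κ hγ
  let D : W.SelmerDualData κ γ := W.selmerDualData κ hγ
  haveI : Module.Finite (IwasawaAlgebra p) DV.X :=
    SelmerDualData.module_finite_of_isCyclotomic V κ hκ DV hγ
  haveI : Module.Finite (IwasawaAlgebra p) D.X :=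
    SelmerDualData.module_finite_of_isCyclotomic W κ hκ D hγ
  obtain ⟨hVt, -, hint⟩ := hkato V κ γ N f hp2 hV hκ hγ hγ' hf DV
  obtain ⟨g₀, hg₀, hιg₀⟩ := hint htower
  obtain ⟨g₁, hg₁, u, hιg₁⟩ := exists_mem_charIdeal_eq_unit_mul_branch_of_katoComponent hK hjW V hp1
    ⟨C, hCW⟩ (Or.inl hV) htower hκ hγ hγ' hf D ϖ hϖ
  have hDt : D.IsTorsion := isTorsion_of_katoComponent hK V hp1 ⟨C, hCW⟩ hV htower hκ hγ hγ' hf D ϖ hϖ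
  refine ⟨g₀ * g₁, ?_, u, ?_⟩
  · rw [charIdeal_towerDual_eq_mul V K h2 hθ hcK p κ hCW hγ hγK hp2 D_K DV D hVt hDt]
    exact Ideal.mul_mem_mul hg₀ hg₁
  · rw [map_mul, hιg₀, hιg₁, map_mul]
    ring

/-- **Kato's divisibility for `V` over the twist field, odd case** (`p ≡ 3 (mod 4)`, `p = 3` included;
`K = ℚ(√−p)`, minus symbols). [cite: Kato2004Asterisque, Thm. 17.4 (p. 273)] [cite: GreenbergLNM1716, §5 p. 143] -/
theorem exists_mem_charIdeal_towerDual_of_kato_odd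
    (hkato : ∀ (V : WeierstrassCurve ℚ) [V.IsElliptic] [V.IsGloballyMinimal] (κ : ZpExtension ℚ p)
      (γ : Field.absoluteGaloisGroup ℚ) (N : ℕ) [NeZero N] (f : CuspForm (Gamma0 N) 2),
      kato_divisibility V p (κ := κ) (γ := γ) (f := f))
    (hK : Kato2004.charIdeal_dvd_padicLFunctionBranch_component_of_surjective)
    (V : WeierstrassCurve ℚ) [V.IsElliptic] [V.IsGloballyMinimal] (K : Type) [Field K] [NumberField K]
    (h2 : Module.finrank ℚ K = 2) {θ : K} (hθ : θ ∉ Set.range (algebraMap ℚ K))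
    (hcK : θ ^ 2 = algebraMap ℚ K (-(p : ℚ))) (κ : ZpExtension ℚ p) [(galRange (K := ℚ) K).Normal]
    {W : WeierstrassCurve ℚ} [W.IsElliptic] {C : VariableChange ℚ}
    (hCW : C • V.quadraticTwist (-(p : ℚ)) = W) {γ : Field.absoluteGaloisGroup ℚ} {N : ℕ} [NeZero N]
    {f : CuspForm (Gamma0 N) 2} (hp3 : p % 4 = 3) (hV : GoodOrd V p)
    (htower : ∀ n : ℕ, V.HasSurjectiveModNGaloisRep (p ^ n : ℕ)) (hκ : κ.IsCyclotomic)
    (hγ : κ.IsTopGenerator γ) (hγ' : IsCyclotomicVariable p γ) (hγK : γ ∈ galRange (K := ℚ) K)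
    (hf : IsNewformOf V f) (D_K : TowerSelmerDualData V κ K γ) (ϖ : ℚ)
    (hϖ : (ϖ : ℝ) * V.imaginaryPeriodRat = minusPeriod f) :
    ∃ g ∈ Literature.NumberTheory.EllipticCurves.Module.charIdeal (IwasawaAlgebra p) D_K.X,
      ∃ u : ℤ_[p]ˣ, iwasawaToPowerSeries p g =
        PowerSeries.C ((u : ℤ_[p]) : ℚ_[p]) * (padicLFunction f (unitRoot V p : ℚ_[p]) *
          (PowerSeries.C ((ϖ : ℚ) : ℚ_[p]) *
            padicLFunctionMinusBranch f (unitRoot V p : ℚ_[p]) (p / 2))) := by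
  have hp2 : p ≠ 2 := by rintro rfl; norm_num at hp3
  have hpne : (-(p : ℚ)) ≠ 0 := neg_ne_zero.mpr (Nat.cast_ne_zero.mpr hp.out.ne_zero)
  haveI : (V.quadraticTwist (-(p : ℚ))).IsElliptic := V.isElliptic_quadraticTwist hpne
  have hjW : 0 ≤ padicValRat p W.j := by
    have hj : W.j = V.j := by subst hCW; rw [variableChange_j, V.j_quadraticTwist hpne]
    rw [hj, Summit.BirchSwinnertonDyer.Rank1Residual.EisensteinPrimes.padicValRat_j_eq_of_good V p hV.1]
    positivity
  let DV : V.SelmerDualData κ γ := V.selmerDualData κ hγ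
  let D : W.SelmerDualData κ γ := W.selmerDualData κ hγ
  haveI : Module.Finite (IwasawaAlgebra p) DV.X :=
    SelmerDualData.module_finite_of_isCyclotomic V κ hκ DV hγ
  haveI : Module.Finite (IwasawaAlgebra p) D.X :=
    SelmerDualData.module_finite_of_isCyclotomic W κ hκ D hγ
  obtain ⟨hVt, -, hint⟩ := hkato V κ γ N f hp2 hV hκ hγ hγ' hf DV
  obtain ⟨g₀, hg₀, hιg₀⟩ := hint htower
  obtain ⟨g₁, hg₁, u, hιg₁⟩ := exists_mem_charIdeal_eq_unit_mul_minusBranch_of_katoComponent hK hjW V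
    hp3 ⟨C, hCW⟩ (Or.inl hV) htower hκ hγ hγ' hf D ϖ hϖ
  have hDt : D.IsTorsion :=
    isTorsion_of_katoComponent_odd hK V hp3 ⟨C, hCW⟩ hV htower hκ hγ hγ' hf D ϖ hϖ
  refine ⟨g₀ * g₁, ?_, u, ?_⟩
  · rw [charIdeal_towerDual_eq_mul V K h2 hθ hcK p κ hCW hγ hγK hp2 D_K DV D hVt hDt]
    exact Ideal.mul_mem_mul hg₀ hg₁
  · rw [map_mul, hιg₀, hιg₁, map_mul]
    ring

end KatoOverK

end Summit.BirchSwinnertonDyer.BirchSwinnertonDyer.Theorems.AdditiveBranchIMCTwistField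

end
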